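import Literature.MathematicalPhysics.QuantumFieldTheory.Balaban1983to89.B9Ineq347GpAtLetters
import Literature.MathematicalPhysics.QuantumFieldTheory.Balaban1983to89.B9Cor35ComparisonsGAAtLetters
import Literature.MathematicalPhysics.QuantumFieldTheory.Balaban1983to89.B6Prop26PrintedKLevelFinalV1

/-!
# `Balaban1983to89.B9Ineq347GAAtLetters` — [B9] (3.47) AT U = 1 FOR G(1) = Δ_a⁻¹ AT NODE 00's OPERATOR LAYER OF LETTERS: ROW 12 OF THE N06
# KNIT (`hGA : B9FromB6.ResidualGAGlobAtOne …`) IS A THEOREM at `ops := Node00.opsYOfLetters N θ M⋆ 𝔏 𝔈`, for EVERY letter record `𝔏` —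
# from [4] Prop. 2.6 (2.136) on the genuine k-level census (N03's theorem of record) and Lemma 2.1 on the torus, exactly as print says

T. Bałaban, *Propagators for lattice gauge theories in a background field*, Commun. Math. Phys. **99** (1985) 389–434
[`Balaban1985BackgroundPropagators`, "B9"]; [4] = T. Bałaban, *Propagators and renormalization transformations for lattice
gauge theories. II*, Commun. Math. Phys. **96** (1984) 223–250 [`Balaban1984PropagatorsII`].

statement-level skeleton of published theorems with citation tags; proofs where landed; nothing here is a claim about the
Yang–Mills mass gap

THE PRINTED LOCI (verbatim).  Thm 3.3, p. 399: *"the same statements hold for the operators G(U)"* (vector arguments); Thm 3.1 (3.47) p. 398: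
*"the global inequalities |G′(U)λ|_{(2+γ)}, |∇_UG′(U)λ|_{(1+γ)}, |G′(U)∇*_Uλ|_{(1+γ)}, |∇_UG′(U)λ|_{(γ)} ≦ B₀|λ|_{(γ)} (3.47) for γ in a fixed
compact subset of real numbers, e.g. for γ ∈ [−4, 4]"*; p. 398: *"It is easy to see that the global inequalities (3.47) are consequences of the
local ones (3.42) and Lemma 2.1."*; Cor. 3.5, p. 407: *"For operators with the external gauge field configuration U = 1, these theorems are
proved in [4]"*; [4] Prop. 2.6 (2.136) p. 247: *"|(GJ)(x)|, |(∇GJ)(x)|, |(G∇*J)(x)|, |(ΔGJ)(x)| ≤ O(1)[(L^jη)², L^jη, L^jη, 1]e^{−δ₃d(y,y′)}|J| for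
x ∈ Δ(y), y ∈ Λ_j, supp J ⊂ Δ(y′)"*.

THE POINT.  Row 12 of the N06 knit — `hGA : B9FromB6.ResidualGAGlobAtOne geo9Y (bg9Y …) (fun x => (ops x).GA)`, the (3.47) entries of G(1) that
[4] does not print (cell GAP G-A1-1 (b)) — is, at NODE 00's layer of letters, EQUIVALENT to its one leaf ON BOND ARGUMENTS
(`B9ResidualEntriesAtOneAtLetters.residualGAGlobAtOne_letters_iff_globOn`).  THIS FILE PROVES THAT LEAF, hence ROW 12, for EVERY letter record `𝔏`
(def-Y's `Node00.CovLettersY` with its printed `U = 1` clause `GA_one`): at `U = 1` def-Y's reading `kernelFamilyB.glob` of G on a product-form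
argument `J ⊗ E` is, entry by entry, the (3.41)-weighted supremum of the LIFT of `GJ`, `∇_νGJ`, `G∇*_νJ`, `ΔGJ` (dag-n06-g's `cdB_one_liftY` ∕
`cdsB_one_liftY` ∕ `lapB_one_liftY`, def-Y's `norm_liftY_le`), `G = Gop = Δ_a⁻¹` r03's GENUINE k-level operator on the fine bonds with the physical
differences `DV ∕ DVa ∕ LapV`; its (3.42) at `U = 1` IS (2.136), the first conjunct of N03's theorem of record
`B6Prop26PrintedKLevelFinalV1.prop26Printed_kLevel` (hypothesis-free on the V1 census, band `0 < b₀ ≤ b₁`); and «(3.42) + Lemma 2.1 ⇒ (3.47)» is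
lit-balaban-p21's engine (`transfer_rpow`, `consts_260_261`, `size_condition`) on the SAME torus block geometry `geomT i.D` — here run with the
fine-bond block map `blkV1` in place of the site block map `blkOf` (§1, a verbatim generalisation of p21's `weighted_sup_of_hasMajorant`).

* §1 `weighted_sup_of_hasMajorant_lin` (p21's engine for any finite carrier and block map), `suppIn_of_blockSupp`, `supNorm_le_of_blockSupp`,
  `hasMajorant_of_census2136` ((2.136) in census form ⇒ `B6RandomWalk.HasMajorant` in the engine's shape).
* §2 ★ `ineq347_G_kIdx (hb₀) (hb₁) (γ₀)` — (3.47) AT U = 1 FOR `Gop` AT EVERY k-LEVEL INDEX ABOVE A THRESHOLD, print's units, pointwise form: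
  `|GJ(b)| ≤ C|J|_{(γ)}(L^{j(b)}η)^{2+γ}`, `|∇_νGJ(b)|, |G∇*_νJ(b)| ≤ C|J|_{(γ)}(L^{j}η)^{1+γ}`, `|ΔGJ(b)| ≤ C|J|_{(γ)}(L^{j}η)^{γ}` (`|γ| ≤ γ₀`).
* §3 `wNormBY_le_of_pointwise`; at a bond-sector letter with the flatness clause: `globB0_one_le` … `globB3_one_le`.
* §4 at a member: `GA_glob_one_inr` (`rfl`), ★ `GA_glob_one_inr_le`.
* §5 ★★ `atOneGlobOn_GA_letters`, ★★ `residualGAGlobAtOne_GA_letters` — ROW 12 HOLDS at the layer of letters for every `𝔏 𝔈` (band hypotheses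
  `0 < b₀ ≤ b₁` of the census); §6 record ★★★ `hGA_opsYOfLetters N θ M⋆ 𝔏 𝔈` — LITERALLY the knit binder `hGA` at `ops := opsYOfLetters N θ M⋆ 𝔏 𝔈`,
  NO hypothesis (band = `θ.hb`); `atOneGlobOn_GA_opsYOfLetters`.

HONEST SCOPE.  Row 12 is DISCHARGED AT THE LAYER OF LETTERS; its analytic content is N03's Prop. 2.6 (2.136) on the V1 census and p21's Lemma 2.1
machinery, both already in the tree and only READ here (constants depend on `d, L` and the band `b₀, b₁`; print: on `d, L`).  The letters are NOT
constructed (def-Y's successor `lettersYOfRecord`); nothing of [B9] beyond the cited sentence is asserted; count-neutral; N06 NOT discharged; one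
finite lattice programme — nothing continuum, nothing about the mass gap.  Cell `pub-ymgap` (HUMAN RULING D-0062), Track A node N06 [B9],
N06-ASSIGNMENT v1 row 12 (bundle F3) at def-Y's instance, seat `pub-ymgap-dag-n06-h` (g2), 2026-08-26.
-/

noncomputable section

namespace Literature.MathematicalPhysics.QuantumFieldTheory.Balaban1983to89.B9Ineq347GAAtLetters

open B6MultiLevelBoxOperator (N0)
open B6MultiLevelTorusOperator (TDomains)
open B6Geom246MultiLevelBox (bset)
open B6Geom246MultiLevelTorus (geomT)
open B6GlobalChartV1 (PV blkV1)
open B6KLevelCensusIndexV1 (KIdx kGeo kGeoG blockSupp_of_suppIn abs_le_supNormG supNormG_nonneg)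
open B6GradLegKLevelV1 (DV)
open B6LapLegKLevelV1 (DVa LapV)
open B6Prop26Census2136KLevelV1 (Gop supIn kG)
open B6RandomWalk (HasMajorant BlockSupp)
open B6Lemma21Repaired (Ineq261With)
open B6 (pref4)
open B8ScaledSupNorm (msup_le_of_pointwise)
open B9GeoNormsKLevelV1 (geo9K wNormB wNormU bddB wNormB_nonneg blkV1_level_le abs_le_of_wNormB_le)
open B9Thm314GpFlatResolvent (abs_le_sum_of_hasMajorant)
open B9Thm314GpFlatMultiLevelTorus (consts_260_261)
open B9Ineq347GpFlatMultiLevelTorus (transfer_rpow size_condition)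
open B9Ineq347GpAtLetters (scale_rpow_split scale_rpow_split₀)
open B9Cor35ComparisonsGAAtLetters (cdB_one_liftY cdsB_one_liftY lapB_one_liftY)
open B9FromB6 (ResidualGAGlobAtOne)
open B9ResidualEntriesAtOne (AtOneGlobOn GlobBlockOn)
open B9ResidualEntriesAtOneAtLetters (residualGAGlobAtOne_letters_of_globOn)
open B9PinMembersKLevelV1 (MemberY geo9Y bg9Y)
open B7Prop2SpecialUnitary (specialUnitaryUnits)
open Node00

variable {d ℓ : ℕ} {hd : 1 ≤ d + 1} {hL : Odd (ℓ + 1) ∧ 1 < ℓ + 1} {b₀ b₁ : ℝ} {Mstar : ℕ}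
variable {𝔸 : Type} [NormedRing 𝔸] [NormedAlgebra ℂ 𝔸] [CompleteSpace 𝔸]

/-! ## §1 Lemma 2.1's engine for any block map; (2.136) in census form as a block majorant -/

section Engine

/-- **p21's engine «(3.42) + Lemma 2.1 ⇒ (3.47)» FOR ANY FINITE CARRIER AND BLOCK MAP** (verbatim generalisation of
`B9Ineq347GpFlatMultiLevelTorus.weighted_sup_of_hasMajorant`, whose carrier is the torus sites with `blkOf`): a block majorant `C₀L^{nj(y)}e^{−δd_T(y,y′)}`
of a linear `T` w.r.t. `blk : X → 𝔅`, (2.61) on the torus at `¼δ` with constant `c`, and the size condition `L^{|γ|} ≤ e^{¾δ(R·L·M_h − 1)}` give, for every `λ`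
with `|λ(z)| ≤ L^{γj(z)}N`: `|(Tλ)(x)| ≤ C₀·c·L^{|γ|}·L^{nj(x)}·L^{γj(x)}·N`.
[cite: Balaban1985BackgroundPropagators, (3.47) p.398 («consequences of the local ones (3.42) and Lemma 2.1»); Balaban1984PropagatorsII, (2.52) p.232, Lemma 2.1 (2.60)–(2.61) p.234] -/
theorem weighted_sup_of_hasMajorant_lin {Mh k R : ℕ} {P : Fin (d + 1) → ℕ} (D : TDomains d ℓ Mh k P R) (hMh : 1 ≤ Mh)
    (hP : ∀ μ, 1 ≤ P μ) (hRM : 1 ≤ R * ((ℓ + 1) * Mh)) {X : Type} [Fintype X] (blk : X → ↥(bset D.toDomains))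
    {T : Module.End ℝ (X → ℝ)} {C₀ δ : ℝ} {n : ℕ} (hC₀ : 0 ≤ C₀) (hδ : 0 ≤ δ)
    (hT : HasMajorant (g := geomT D) blk T
      (fun y y' => C₀ * ((ℓ : ℝ) + 1) ^ (n * y.1.1) * Real.exp (-(δ * (geomT D).dist y y'))))
    {c : ℝ} (h261 : Ineq261With c (geomT D) δ (1 / 4)) (γ : ℝ)
    (hthr : ((ℓ : ℝ) + 1) ^ |γ| ≤ Real.exp (3 / 4 * δ * ((R : ℝ) * (((ℓ : ℝ) + 1) * Mh) - 1)))
    {lam : X → ℝ} {N : ℝ} (hN : 0 ≤ N)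
    (hlam : ∀ z, |lam z| ≤ ((ℓ : ℝ) + 1) ^ (γ * ((blk z).1.1 : ℝ)) * N) (x : X) :
    |T lam x| ≤ C₀ * c * ((ℓ : ℝ) + 1) ^ |γ| * ((ℓ : ℝ) + 1) ^ (n * (blk x).1.1)
      * ((ℓ : ℝ) + 1) ^ (γ * ((blk x).1.1 : ℝ)) * N := by
  have hL0 : (0 : ℝ) < (ℓ : ℝ) + 1 := by positivity
  have hU0 : ∀ b : ↥(bset D.toDomains), 0 ≤ ((ℓ : ℝ) + 1) ^ (γ * (b.1.1 : ℝ)) * N := fun b => by positivity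
  have h := abs_le_sum_of_hasMajorant (g := geomT D) blk hT lam (fun b => ((ℓ : ℝ) + 1) ^ (γ * (b.1.1 : ℝ)) * N) hU0 hlam x
  refine h.trans ?_
  have hterm : ∀ b : ↥(bset D.toDomains),
      C₀ * ((ℓ : ℝ) + 1) ^ (n * (blk x).1.1) * Real.exp (-(δ * (geomT D).dist (blk x) b))
        * (((ℓ : ℝ) + 1) ^ (γ * (b.1.1 : ℝ)) * N)
      ≤ C₀ * ((ℓ : ℝ) + 1) ^ |γ| * ((ℓ : ℝ) + 1) ^ (n * (blk x).1.1) * ((ℓ : ℝ) + 1) ^ (γ * ((blk x).1.1 : ℝ)) * N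
        * Real.exp (-(1 / 4 * δ * (geomT D).dist (blk x) b)) := by
    intro b
    have htr := transfer_rpow D hMh hP hRM hδ γ hthr (blk x) b
    have hsplit : Real.exp (-(δ * (geomT D).dist (blk x) b))
        = Real.exp (-(1 / 4 * δ * (geomT D).dist (blk x) b)) * Real.exp (-(3 / 4 * δ * (geomT D).dist (blk x) b)) := by
      rw [← Real.exp_add]; congr 1; ring
    rw [hsplit]
    calc C₀ * ((ℓ : ℝ) + 1) ^ (n * (blk x).1.1)
          * (Real.exp (-(1 / 4 * δ * (geomT D).dist (blk x) b)) * Real.exp (-(3 / 4 * δ * (geomT D).dist (blk x) b)))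
          * (((ℓ : ℝ) + 1) ^ (γ * (b.1.1 : ℝ)) * N)
        = C₀ * ((ℓ : ℝ) + 1) ^ (n * (blk x).1.1) * N * Real.exp (-(1 / 4 * δ * (geomT D).dist (blk x) b))
          * (Real.exp (-(3 / 4 * δ * (geomT D).dist (blk x) b)) * ((ℓ : ℝ) + 1) ^ (γ * (b.1.1 : ℝ))) := by ring
      _ ≤ C₀ * ((ℓ : ℝ) + 1) ^ (n * (blk x).1.1) * N * Real.exp (-(1 / 4 * δ * (geomT D).dist (blk x) b))
          * (((ℓ : ℝ) + 1) ^ |γ| * ((ℓ : ℝ) + 1) ^ (γ * ((blk x).1.1 : ℝ))) :=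
          mul_le_mul_of_nonneg_left htr (by positivity)
      _ = _ := by ring
  calc ∑ b, C₀ * ((ℓ : ℝ) + 1) ^ (n * (blk x).1.1) * Real.exp (-(δ * (geomT D).dist (blk x) b))
          * (((ℓ : ℝ) + 1) ^ (γ * (b.1.1 : ℝ)) * N)
      ≤ ∑ b, C₀ * ((ℓ : ℝ) + 1) ^ |γ| * ((ℓ : ℝ) + 1) ^ (n * (blk x).1.1) * ((ℓ : ℝ) + 1) ^ (γ * ((blk x).1.1 : ℝ)) * N
          * Real.exp (-(1 / 4 * δ * (geomT D).dist (blk x) b)) := Finset.sum_le_sum fun b _ => hterm b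
    _ = C₀ * ((ℓ : ℝ) + 1) ^ |γ| * ((ℓ : ℝ) + 1) ^ (n * (blk x).1.1) * ((ℓ : ℝ) + 1) ^ (γ * ((blk x).1.1 : ℝ)) * N
          * ∑ b, Real.exp (-(1 / 4 * δ * (geomT D).dist (blk x) b)) := by rw [Finset.mul_sum]
    _ ≤ C₀ * ((ℓ : ℝ) + 1) ^ |γ| * ((ℓ : ℝ) + 1) ^ (n * (blk x).1.1) * ((ℓ : ℝ) + 1) ^ (γ * ((blk x).1.1 : ℝ)) * N * c :=
        mul_le_mul_of_nonneg_left (h261 (blk x)) (by positivity)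
    _ = _ := by ring

variable (i : KIdx d ℓ hd hL b₀ b₁)

/-- a block-supported bond function in the majorant language is block-supported in the census language («supp J ⊂ Δ(y′)»).
[cite: Balaban1984PropagatorsII, (2.51) p.232 + Prop. 2.6 p.247 («supp J ⊂ Δ(y′)»), dictionary] -/
theorem suppIn_of_blockSupp {J : FBondY i → ℝ} {y' : (geomT i.D).Site} {B : ℝ}
    (h : BlockSupp (g := geomT i.D) (blkV1 i.hN i.D) J y' B) : (kGeoG i).suppIn J y' :=
  fun x hx => by
    by_contra hne
    exact hx (h.off x hne)

/-- … and its sup norm is at most the majorant bound `B`. [cite: Balaban1984PropagatorsII, (2.51) p.232, dictionary] -/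
theorem supNorm_le_of_blockSupp {J : FBondY i → ℝ} {y' : (geomT i.D).Site} {B : ℝ}
    (h : BlockSupp (g := geomT i.D) (blkV1 i.hN i.D) J y' B) : (kGeoG i).supNorm J ≤ B := by
  refine Real.iSup_le (fun x => ?_) h.nonneg
  by_cases hx : blkV1 i.hN i.D x = y'
  · exact h.bound x hx
  · rw [h.off x hx, abs_zero]; exact h.nonneg

/-- a value on a fine bond of the block `y` is below the census sup `sup_{x ∈ Δ(y)} |f(x)|` (r03's `supIn`).
[cite: Balaban1984PropagatorsII, Prop. 2.6 (2.136) p.247 («for x ∈ Δ(y)»), bookkeeping] -/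
theorem abs_le_supIn (f : FBondY i → ℝ) (x : FBondY i) : |f x| ≤ supIn i (blkV1 i.hN i.D x) f :=
  le_ciSup (f := fun z : {z : FBondY i // blkV1 i.hN i.D z = blkV1 i.hN i.D x} => |f z.1|) (Set.finite_range _).bddAbove ⟨x, rfl⟩

/-- **(2.136) IN CENSUS FORM ⇒ A BLOCK MAJORANT IN THE ENGINE'S SHAPE**: if entry `n` of r03's census reading `kG` dominates `|T·|` blockwise and obeys the
(2.136)-shaped bound with prefactor `pref4 (L^{j}η) n = (L^{j}η)^m`, then `T` has the majorant `(C′η^m)·L^{mj(y)}·e^{−δ₃d_T(y,y′)}` w.r.t. the fine-bond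
block map. [cite: Balaban1984PropagatorsII, Prop. 2.6 (2.136) p.247 + (2.51) p.232] -/
theorem hasMajorant_of_census2136 {T : Module.End ℝ (FBondY i → ℝ)} (n : Fin 4) (m : ℕ) {C' δ₃ : ℝ} (hC' : 0 ≤ C')
    (h2136 : ∀ (J : FBondY i → ℝ) (y y' : (geomT i.D).Site), (kGeoG i).suppIn J y' →
      (kG i).e n J y ≤ C' * pref4 ((kGeoG i).len y) n * Real.exp (-(δ₃ * (kGeoG i).dist y y')) * (kGeoG i).supNorm J)
    (hpref : ∀ t : ℝ, pref4 t n = t ^ m)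
    (hT : ∀ (J : FBondY i → ℝ) (x : FBondY i), |T J x| ≤ (kG i).e n J (blkV1 i.hN i.D x)) :
    HasMajorant (g := geomT i.D) (blkV1 i.hN i.D) T
      (fun y y' => C' * |i.cf|⁻¹ ^ m * ((ℓ : ℝ) + 1) ^ (m * y.1.1) * Real.exp (-(δ₃ * (geomT i.D).dist y y'))) := by
  intro y' J B hB x
  show |T J x| ≤ C' * |i.cf|⁻¹ ^ m * ((ℓ : ℝ) + 1) ^ (m * (blkV1 i.hN i.D x).1.1) *
    Real.exp (-(δ₃ * (geomT i.D).dist (blkV1 i.hN i.D x) y')) * B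
  have hlen : (kGeoG i).len (blkV1 i.hN i.D x) = (((ℓ + 1 : ℕ) : ℝ)) ^ (blkV1 i.hN i.D x).1.1 * |i.cf|⁻¹ := rfl
  have hdist : (kGeoG i).dist (blkV1 i.hN i.D x) y' = (geomT i.D).dist (blkV1 i.hN i.D x) y' := rfl
  have h := h2136 J (blkV1 i.hN i.D x) y' (suppIn_of_blockSupp i hB)
  rw [hpref, hlen, hdist] at h
  push_cast at h
  have hexp0 : 0 ≤ C' * (((ℓ : ℝ) + 1) ^ (blkV1 i.hN i.D x).1.1 * |i.cf|⁻¹) ^ m *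
      Real.exp (-(δ₃ * (geomT i.D).dist (blkV1 i.hN i.D x) y')) := by positivity
  calc |T J x| ≤ (kG i).e n J (blkV1 i.hN i.D x) := hT J x
    _ ≤ C' * (((ℓ : ℝ) + 1) ^ (blkV1 i.hN i.D x).1.1 * |i.cf|⁻¹) ^ m *
        Real.exp (-(δ₃ * (geomT i.D).dist (blkV1 i.hN i.D x) y')) * (kGeoG i).supNorm J := h
    _ ≤ C' * (((ℓ : ℝ) + 1) ^ (blkV1 i.hN i.D x).1.1 * |i.cf|⁻¹) ^ m *
        Real.exp (-(δ₃ * (geomT i.D).dist (blkV1 i.hN i.D x) y')) * B :=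
        mul_le_mul_of_nonneg_left (supNorm_le_of_blockSupp i hB) hexp0
    _ = C' * |i.cf|⁻¹ ^ m * ((ℓ : ℝ) + 1) ^ (m * (blkV1 i.hN i.D x).1.1) *
        Real.exp (-(δ₃ * (geomT i.D).dist (blkV1 i.hN i.D x) y')) * B := by
        rw [mul_pow, ← pow_mul']
        ring

end Engine

/-! ## §2 (3.47) at U = 1 for r03's `G = Gop = Δ_a⁻¹` on the fine bonds, every k-level index, print's units, pointwise form -/

section KLevel

/-- ★ **(3.47) AT `U = 1` FOR `G = Δ_a⁻¹` (r03's `Gop`, physical differences `DV ∕ DVa ∕ LapV`) AT EVERY k-LEVEL V1 INDEX ABOVE A THRESHOLD — PRINT'S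
UNITS, POINTWISE FORM.**  For the band `0 < b₀ ≤ b₁` and every `γ₀` there are `M₁, C > 0` such that for every index `i` with `M = L·M_h ≥ M₁`, every
real `γ` with `|γ| ≤ γ₀`, every `J` and every fine bond `b` (level `j(b)` of its block, `η = |c_f|⁻¹`): `|(GJ)(b)| ≤ C|J|_{(γ)}(L^{j}η)^{2+γ}`,
`|(∇_νGJ)(b)| ≤ C|J|_{(γ)}(L^{j}η)^{1+γ}`, `|(G∇*_νJ)(b)| ≤ C|J|_{(γ)}(L^{j}η)^{1+γ}` (all `ν`), `|(ΔGJ)(b)| ≤ C|J|_{(γ)}(L^{j}η)^{γ}`.  N03's (2.136)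
(`prop26Printed_kLevel`, first conjunct) as block majorants + p21's Lemma 2.1 engine on the bond block map.
[cite: Balaban1985BackgroundPropagators, Thm 3.3 p.399 + Thm 3.1 (3.47), (3.41) pp.397–398; Balaban1984PropagatorsII, Prop. 2.6 (2.136) p.247, Lemma 2.1 (2.60)–(2.61) p.234] -/
theorem ineq347_G_kIdx (hb₀ : 0 < b₀) (hb₁ : b₀ ≤ b₁) (γ₀ : ℝ) : ∃ M₁ C : ℝ, 0 < M₁ ∧ 0 < C ∧
    ∀ i : KIdx d ℓ hd hL b₀ b₁, M₁ ≤ (kGeo i).M → ∀ γ : ℝ, |γ| ≤ γ₀ → ∀ (J : FBondY i → ℝ) (b : FBondY i),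
      |Gop i J b| ≤ C * wNormB i γ J * (((ℓ : ℝ) + 1) ^ (blkV1 i.hN i.D b).1.1 * |i.cf|⁻¹) ^ ((2 : ℝ) + γ) ∧
      (∀ ν : Fin (d + 1), |DV ν i.cf (Gop i J) b| ≤
          C * wNormB i γ J * (((ℓ : ℝ) + 1) ^ (blkV1 i.hN i.D b).1.1 * |i.cf|⁻¹) ^ ((1 : ℝ) + γ)) ∧
      (∀ ν : Fin (d + 1), |Gop i (DVa ν i.cf J) b| ≤
          C * wNormB i γ J * (((ℓ : ℝ) + 1) ^ (blkV1 i.hN i.D b).1.1 * |i.cf|⁻¹) ^ ((1 : ℝ) + γ)) ∧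
      |LapV i.cf (Gop i J) b| ≤ C * wNormB i γ J * (((ℓ : ℝ) + 1) ^ (blkV1 i.hN i.D b).1.1 * |i.cf|⁻¹) ^ γ := by
  obtain ⟨M₁', δ₃, C', Cα, Cε, Cαε, hM₁', hδ₃, hC', H⟩ :=
    B6Prop26PrintedKLevelFinalV1.prop26Printed_kLevel (d := d) (ℓ := ℓ) (hd := hd) (hL := hL) hb₀ hb₁
  have hL0 : (0 : ℝ) < (ℓ : ℝ) + 1 := by positivity
  have hL1 : (1 : ℝ) ≤ (ℓ : ℝ) + 1 := by linarith [(Nat.cast_nonneg ℓ : (0 : ℝ) ≤ ℓ)]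
  have hδq : (0 : ℝ) < δ₃ / (⌈γ₀⌉₊ + 1 : ℕ) := by positivity
  obtain ⟨Nq, cq, -, -, hconq⟩ := consts_260_261 d ℓ hδq
  obtain ⟨Nc, c, -, hc, hcon⟩ := consts_260_261 d ℓ hδ₃
  refine ⟨max M₁' (((max Nq Nc : ℕ) : ℝ) + 1), C' * (c + 1) * ((ℓ : ℝ) + 1) ^ γ₀, lt_max_of_lt_left hM₁', by positivity, ?_⟩
  intro i hM γ hγ J b
  have hLcast : (((ℓ + 1 : ℕ) : ℝ)) = (ℓ : ℝ) + 1 := by push_cast; ring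
  have hM' : max M₁' (((max Nq Nc : ℕ) : ℝ) + 1) ≤ ((ℓ : ℝ) + 1) * i.Mh := by
    have hMdef : (kGeo i).M = (((ℓ + 1 : ℕ) : ℝ)) * (i.Mh : ℝ) := rfl
    rw [hMdef, hLcast] at hM
    exact hM
  have hM₁'' : M₁' ≤ (kGeoG i).M := by
    have hMdef : (kGeoG i).M = (((ℓ + 1 : ℕ) : ℝ)) * (i.Mh : ℝ) := rfl
    rw [hMdef, hLcast]
    exact (le_max_left _ _).trans hM'
  have h2136 := (H i trivial hM₁'').1
  have hMh1 : 1 ≤ i.Mh := le_trans (by norm_num) i.hM8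
  have hR1 : 1 ≤ i.R := le_trans (by omega) (toKT i).hR
  have hRN : ∀ N : ℕ, N ≤ max Nq Nc → N + 1 ≤ i.R * ((ℓ + 1) * i.Mh) := by
    intro N hN
    have h1 : (((max Nq Nc : ℕ) : ℝ) + 1) ≤ ((ℓ : ℝ) + 1) * i.Mh := (le_max_right _ _).trans hM'
    have h2 : max Nq Nc + 1 ≤ (ℓ + 1) * i.Mh := by exact_mod_cast h1
    calc N + 1 ≤ 1 * ((ℓ + 1) * i.Mh) := by rw [one_mul]; omega
      _ ≤ i.R * ((ℓ + 1) * i.Mh) := Nat.mul_le_mul_right _ hR1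
  have hRM1 : 1 ≤ i.R * ((ℓ + 1) * i.Mh) := le_trans (by omega) (hRN 0 (Nat.zero_le _))
  obtain ⟨hthrq, -⟩ := hconq i.k i.Mh i.R i.P' hMh1 (toKT i).hP (hRN Nq (le_max_left _ _))
  obtain ⟨-, h261⟩ := hcon i.k i.Mh i.R i.P' hMh1 (toKT i).hP (hRN Nc (le_max_right _ _))
  have h261D : Ineq261With c (geomT i.D) δ₃ (1 / 4) := h261 i.D
  have hX : 0 ≤ (i.R : ℝ) * (((ℓ : ℝ) + 1) * i.Mh) - 1 := by
    have : (1 : ℝ) ≤ (i.R : ℝ) * (((ℓ : ℝ) + 1) * i.Mh) := by exact_mod_cast hRM1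
    linarith
  have hsize := size_condition (ℓ := ℓ) hδ₃.le hγ hX hthrq
  have hη : 0 < |i.cf|⁻¹ := inv_pos.2 (abs_pos.2 i.hcf)
  have hN : 0 ≤ wNormB i γ J := wNormB_nonneg i γ J
  -- `|J(z)| ≤ L^{γ j(z)}·(|J|_{(γ)} η^γ)`
  have hlam : ∀ z : FBondY i, |J z| ≤ ((ℓ : ℝ) + 1) ^ (γ * ((blkV1 i.hN i.D z).1.1 : ℝ)) * (wNormB i γ J * |i.cf|⁻¹ ^ γ) := by
    intro z
    have h := abs_le_of_wNormB_le i (le_refl (wNormB i γ J)) z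
    push_cast at h
    rw [scale_rpow_split₀ hL0 hη] at h
    calc |J z| ≤ _ := h
      _ = _ := by ring
  -- the four block majorants from (2.136)
  have hm0 : HasMajorant (g := geomT i.D) (blkV1 i.hN i.D) (Gop i)
      (fun y y' => C' * |i.cf|⁻¹ ^ 2 * ((ℓ : ℝ) + 1) ^ (2 * y.1.1) * Real.exp (-(δ₃ * (geomT i.D).dist y y'))) :=
    hasMajorant_of_census2136 i 0 2 hC'.le (h2136 0) (fun t => by simp [pref4]) fun J x => abs_le_supIn i (Gop i J) x
  have hm1 : ∀ ν : Fin (d + 1), HasMajorant (g := geomT i.D) (blkV1 i.hN i.D) (DV ν i.cf ∘ₗ Gop i)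
      (fun y y' => C' * |i.cf|⁻¹ ^ 1 * ((ℓ : ℝ) + 1) ^ (1 * y.1.1) * Real.exp (-(δ₃ * (geomT i.D).dist y y'))) := by
    intro ν
    refine hasMajorant_of_census2136 i 1 1 hC'.le (h2136 1) (fun t => by simp [pref4]) fun J x => ?_
    exact (abs_le_supIn i ((DV ν i.cf ∘ₗ Gop i) J) x).trans
      (le_ciSup (f := fun ν : Fin (d + 1) => supIn i (blkV1 i.hN i.D x) ((DV ν i.cf ∘ₗ Gop i) J)) (Set.finite_range _).bddAbove ν)
  have hm2 : ∀ ν : Fin (d + 1), HasMajorant (g := geomT i.D) (blkV1 i.hN i.D) (Gop i ∘ₗ DVa ν i.cf)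
      (fun y y' => C' * |i.cf|⁻¹ ^ 1 * ((ℓ : ℝ) + 1) ^ (1 * y.1.1) * Real.exp (-(δ₃ * (geomT i.D).dist y y'))) := by
    intro ν
    refine hasMajorant_of_census2136 i 2 1 hC'.le (h2136 2) (fun t => by simp [pref4]) fun J x => ?_
    exact (abs_le_supIn i ((Gop i ∘ₗ DVa ν i.cf) J) x).trans
      (le_ciSup (f := fun ν : Fin (d + 1) => supIn i (blkV1 i.hN i.D x) ((Gop i ∘ₗ DVa ν i.cf) J)) (Set.finite_range _).bddAbove ν)
  have hm3 : HasMajorant (g := geomT i.D) (blkV1 i.hN i.D) (LapV i.cf ∘ₗ Gop i)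
      (fun y y' => C' * |i.cf|⁻¹ ^ 0 * ((ℓ : ℝ) + 1) ^ (0 * y.1.1) * Real.exp (-(δ₃ * (geomT i.D).dist y y'))) :=
    hasMajorant_of_census2136 i 3 0 hC'.le (h2136 3) (fun t => by simp [pref4]) fun J x => abs_le_supIn i ((LapV i.cf ∘ₗ Gop i) J) x
  -- constants bookkeeping
  have hLγ : ((ℓ : ℝ) + 1) ^ |γ| ≤ ((ℓ : ℝ) + 1) ^ γ₀ := Real.rpow_le_rpow_of_exponent_le hL1 hγ
  have hkey : c * ((ℓ : ℝ) + 1) ^ |γ| ≤ (c + 1) * ((ℓ : ℝ) + 1) ^ γ₀ :=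
    mul_le_mul (by linarith) hLγ (Real.rpow_nonneg hL0.le _) (by linarith)
  have hfin : ∀ (m : ℕ) (W : ℝ), 0 ≤ W →
      C' * |i.cf|⁻¹ ^ m * c * ((ℓ : ℝ) + 1) ^ |γ| * ((ℓ : ℝ) + 1) ^ (m * (blkV1 i.hN i.D b).1.1)
        * ((ℓ : ℝ) + 1) ^ (γ * ((blkV1 i.hN i.D b).1.1 : ℝ)) * (wNormB i γ J * |i.cf|⁻¹ ^ γ)
      ≤ C' * (c + 1) * ((ℓ : ℝ) + 1) ^ γ₀ * wNormB i γ J *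
        (((ℓ : ℝ) + 1) ^ (m * (blkV1 i.hN i.D b).1.1) * |i.cf|⁻¹ ^ m *
          (((ℓ : ℝ) + 1) ^ (γ * ((blkV1 i.hN i.D b).1.1 : ℝ)) * |i.cf|⁻¹ ^ γ)) := by
    intro m W _
    have hA : 0 ≤ C' * (((ℓ : ℝ) + 1) ^ (m * (blkV1 i.hN i.D b).1.1) * |i.cf|⁻¹ ^ m *
        (((ℓ : ℝ) + 1) ^ (γ * ((blkV1 i.hN i.D b).1.1 : ℝ)) * |i.cf|⁻¹ ^ γ)) * wNormB i γ J := by positivity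
    calc C' * |i.cf|⁻¹ ^ m * c * ((ℓ : ℝ) + 1) ^ |γ| * ((ℓ : ℝ) + 1) ^ (m * (blkV1 i.hN i.D b).1.1)
          * ((ℓ : ℝ) + 1) ^ (γ * ((blkV1 i.hN i.D b).1.1 : ℝ)) * (wNormB i γ J * |i.cf|⁻¹ ^ γ)
        = C' * (((ℓ : ℝ) + 1) ^ (m * (blkV1 i.hN i.D b).1.1) * |i.cf|⁻¹ ^ m *
            (((ℓ : ℝ) + 1) ^ (γ * ((blkV1 i.hN i.D b).1.1 : ℝ)) * |i.cf|⁻¹ ^ γ)) * wNormB i γ J * (c * ((ℓ : ℝ) + 1) ^ |γ|) := by ring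
      _ ≤ C' * (((ℓ : ℝ) + 1) ^ (m * (blkV1 i.hN i.D b).1.1) * |i.cf|⁻¹ ^ m *
            (((ℓ : ℝ) + 1) ^ (γ * ((blkV1 i.hN i.D b).1.1 : ℝ)) * |i.cf|⁻¹ ^ γ)) * wNormB i γ J * ((c + 1) * ((ℓ : ℝ) + 1) ^ γ₀) :=
          mul_le_mul_of_nonneg_left hkey hA
      _ = _ := by ring
  -- the scale powers
  have e2 : (((ℓ : ℝ) + 1) ^ (blkV1 i.hN i.D b).1.1 * |i.cf|⁻¹) ^ ((2 : ℝ) + γ) =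
      ((ℓ : ℝ) + 1) ^ (2 * (blkV1 i.hN i.D b).1.1) * |i.cf|⁻¹ ^ 2 *
        (((ℓ : ℝ) + 1) ^ (γ * ((blkV1 i.hN i.D b).1.1 : ℝ)) * |i.cf|⁻¹ ^ γ) := by
    have h := scale_rpow_split hL0 hη (blkV1 i.hN i.D b).1.1 2 γ
    push_cast at h
    exact h
  have e1 : (((ℓ : ℝ) + 1) ^ (blkV1 i.hN i.D b).1.1 * |i.cf|⁻¹) ^ ((1 : ℝ) + γ) =
      ((ℓ : ℝ) + 1) ^ (1 * (blkV1 i.hN i.D b).1.1) * |i.cf|⁻¹ ^ 1 *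
        (((ℓ : ℝ) + 1) ^ (γ * ((blkV1 i.hN i.D b).1.1 : ℝ)) * |i.cf|⁻¹ ^ γ) := by
    have h := scale_rpow_split hL0 hη (blkV1 i.hN i.D b).1.1 1 γ
    push_cast at h
    exact h
  have e0 : (((ℓ : ℝ) + 1) ^ (blkV1 i.hN i.D b).1.1 * |i.cf|⁻¹) ^ γ =
      ((ℓ : ℝ) + 1) ^ (0 * (blkV1 i.hN i.D b).1.1) * |i.cf|⁻¹ ^ 0 *
        (((ℓ : ℝ) + 1) ^ (γ * ((blkV1 i.hN i.D b).1.1 : ℝ)) * |i.cf|⁻¹ ^ γ) := by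
    rw [scale_rpow_split₀ hL0 hη, zero_mul, pow_zero, pow_zero, one_mul, one_mul]
  have hNη : 0 ≤ wNormB i γ J * |i.cf|⁻¹ ^ γ := by positivity
  refine ⟨?_, fun ν => ?_, fun ν => ?_, ?_⟩
  · have h := weighted_sup_of_hasMajorant_lin i.D hMh1 (toKT i).hP hRM1 (blkV1 i.hN i.D) (by positivity) hδ₃.le hm0 h261D γ
      hsize hNη hlam b
    rw [e2]
    exact h.trans (le_of_eq_of_le (by ring) (hfin 2 _ le_rfl))
  · have h := weighted_sup_of_hasMajorant_lin i.D hMh1 (toKT i).hP hRM1 (blkV1 i.hN i.D) (by positivity) hδ₃.le (hm1 ν) h261D γ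
      hsize hNη hlam b
    rw [e1]
    exact h.trans (le_of_eq_of_le (by ring) (hfin 1 _ le_rfl))
  · have h := weighted_sup_of_hasMajorant_lin i.D hMh1 (toKT i).hP hRM1 (blkV1 i.hN i.D) (by positivity) hδ₃.le (hm2 ν) h261D γ
      hsize hNη hlam b
    rw [e1]
    exact h.trans (le_of_eq_of_le (by ring) (hfin 1 _ le_rfl))
  · have h := weighted_sup_of_hasMajorant_lin i.D hMh1 (toKT i).hP hRM1 (blkV1 i.hN i.D) (by positivity) hδ₃.le hm3 h261D γ
      hsize hNη hlam b
    rw [e0]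
    exact h.trans (le_of_eq_of_le (by ring) (hfin 0 _ le_rfl))

end KLevel

/-! ## §3 The (3.41) norm of `𝔸`-valued bond functions; the four (3.47) members of the reading at a bond-sector letter -/

section Letter

variable (i : KIdx d ℓ hd hL b₀ b₁)

omit [NormedAlgebra ℂ 𝔸] [CompleteSpace 𝔸] in
/-- a pointwise bound `‖Ψ(b)‖ ≤ c·(L^{j(b)}η)^α` (`c ≥ 0`) on the fine bonds gives `|Ψ|_{(α)} ≤ c` (def-Y's `wNormBY`).
[cite: Balaban1985BackgroundPropagators, (3.41) p.397] -/
theorem wNormBY_le_of_pointwise {α c : ℝ} (hc : 0 ≤ c) {Ψ : FBondY i → 𝔸}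
    (h : ∀ b : FBondY i, ‖Ψ b‖ ≤ c * (((ℓ : ℝ) + 1) ^ (blkV1 i.hN i.D b).1.1 * |i.cf|⁻¹) ^ α) : wNormBY i α Ψ ≤ c := by
  unfold wNormBY
  refine msup_le_of_pointwise (Nat.succ_le_succ (Nat.zero_le ℓ)) (inv_pos.2 (abs_pos.2 i.hcf)) hc fun j _ b hb => ?_
  have h' := h b
  have hj : (blkV1 i.hN i.D b).1.1 = j := hb
  rw [hj] at h'
  push_cast
  exact h'

variable (O : BondOpY 𝔸 i)
  (hO : ∀ (J : FBondY i → ℝ) (E : 𝔸), O (fun _ _ => 1) (liftY J E) = liftY (Gop i J) E)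
include hO

/-- **(3.47)₁ for G's reading at `U = 1` on `J ⊗ E`**: `|G(1)(J ⊗ E)|_{(2+γ)} ≤ C|J|_{(γ)}` given §2's first pointwise bound (`‖E‖ ≤ 1`).
[cite: Balaban1985BackgroundPropagators, Thm 3.3 p.399 + (3.47) p.398 + Cor. 3.5 p.407] -/
theorem globB0_one_le (J : FBondY i → ℝ) (E : BallY 𝔸) {γ C : ℝ} (hC : 0 ≤ C)
    (h0 : ∀ b : FBondY i, |Gop i J b| ≤ C * wNormB i γ J * (((ℓ : ℝ) + 1) ^ (blkV1 i.hN i.D b).1.1 * |i.cf|⁻¹) ^ ((2 : ℝ) + γ)) :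
    wNormBY i (2 + γ) (O (fun _ _ => 1) (liftY J (E : 𝔸))) ≤ C * wNormB i γ J := by
  refine wNormBY_le_of_pointwise i (mul_nonneg hC (wNormB_nonneg i γ J)) fun b => ?_
  rw [hO]
  exact (norm_liftY_le _ E b).trans (h0 b)

/-- **(3.47)₂ for G's reading at `U = 1` on `J ⊗ E`, direction `ν`**: `|∇_{1,ν}G(1)(J ⊗ E)|_{(1+γ)} ≤ C|J|_{(γ)}` given §2's second bound.
[cite: Balaban1985BackgroundPropagators, Thm 3.3 p.399 + (3.47) p.398 + (3.3) p.390] -/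
theorem globB1_one_le (J : FBondY i → ℝ) (E : BallY 𝔸) (ν : Fin (d + 1)) {γ C : ℝ} (hC : 0 ≤ C)
    (h1 : ∀ b : FBondY i, |DV ν i.cf (Gop i J) b| ≤ C * wNormB i γ J * (((ℓ : ℝ) + 1) ^ (blkV1 i.hN i.D b).1.1 * |i.cf|⁻¹) ^ ((1 : ℝ) + γ)) :
    wNormBY i (1 + γ) (cdB i (fun _ _ => 1) ν (O (fun _ _ => 1) (liftY J (E : 𝔸)))) ≤ C * wNormB i γ J := by
  refine wNormBY_le_of_pointwise i (mul_nonneg hC (wNormB_nonneg i γ J)) fun b => ?_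
  rw [hO, cdB_one_liftY]
  exact (norm_liftY_le _ E b).trans (h1 b)

/-- **(3.47)₃ for G's reading at `U = 1` on `J ⊗ E`, direction `ν`**: `|G(1)∇*_{1,ν}(J ⊗ E)|_{(1+γ)} ≤ C|J|_{(γ)}` given §2's third bound.
[cite: Balaban1985BackgroundPropagators, Thm 3.3 p.399 + (3.47) p.398 + (3.8) p.392] -/
theorem globB2_one_le (J : FBondY i → ℝ) (E : BallY 𝔸) (ν : Fin (d + 1)) {γ C : ℝ} (hC : 0 ≤ C)
    (h2 : ∀ b : FBondY i, |Gop i (DVa ν i.cf J) b| ≤ C * wNormB i γ J * (((ℓ : ℝ) + 1) ^ (blkV1 i.hN i.D b).1.1 * |i.cf|⁻¹) ^ ((1 : ℝ) + γ)) :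
    wNormBY i (1 + γ) (O (fun _ _ => 1) (cdsB i (fun _ _ => 1) ν (liftY J (E : 𝔸)))) ≤ C * wNormB i γ J := by
  refine wNormBY_le_of_pointwise i (mul_nonneg hC (wNormB_nonneg i γ J)) fun b => ?_
  rw [cdsB_one_liftY, hO]
  exact (norm_liftY_le _ E b).trans (h2 b)

/-- **(3.47)₄ for G's reading at `U = 1` on `J ⊗ E`**: `|Δ_1G(1)(J ⊗ E)|_{(γ)} ≤ C|J|_{(γ)}` given §2's fourth bound.
[cite: Balaban1985BackgroundPropagators, Thm 3.3 p.399 + (3.47) p.398 + (3.23) p.395] -/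
theorem globB3_one_le (J : FBondY i → ℝ) (E : BallY 𝔸) {γ C : ℝ} (hC : 0 ≤ C)
    (h3 : ∀ b : FBondY i, |LapV i.cf (Gop i J) b| ≤ C * wNormB i γ J * (((ℓ : ℝ) + 1) ^ (blkV1 i.hN i.D b).1.1 * |i.cf|⁻¹) ^ γ) :
    wNormBY i γ (lapB i (fun _ _ => 1) (O (fun _ _ => 1) (liftY J (E : 𝔸)))) ≤ C * wNormB i γ J := by
  refine wNormBY_le_of_pointwise i (mul_nonneg hC (wNormB_nonneg i γ J)) fun b => ?_
  rw [hO, lapB_one_liftY]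
  exact (norm_liftY_le _ E b).trans (h3 b)

end Letter

/-! ## §4 At a member: the (3.47) slot of def-Y's G-reading at `U = 1` on a bond argument -/

section Member

variable {G : Subgroup 𝔸ˣ} (x : MemberY d ℓ hd hL b₀ b₁ Mstar) (𝔏 : CovLettersY 𝔸 x) (𝔈 : ExpLettersY 𝔸 G x)

/-- the (3.47) slot of def-Y's layer for G at `U = 1` on a bond argument, unfolded (`kernelFamilyB.glob` on `.inr J`).
[cite: Balaban1985BackgroundPropagators, (3.47) p.398 + Thm 3.3 p.399 (the reading; bookkeeping)] -/
theorem GA_glob_one_inr (n : Fin 4) (J : FBondY x.toKIdx → ℝ) (γ : ℝ) :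
    (operatorLayerYOfLetters 𝔸 G x 𝔏 𝔈).GA.glob n (bg9Y 𝔸 G x).one (Sum.inr J) γ =
      ⨆ E : BallY 𝔸,
        ((![wNormBY x.toKIdx (2 + γ) (𝔏.GA (fun _ _ => 1) (liftY J (E : 𝔸))),
            ⨆ ν : Fin (d + 1), wNormBY x.toKIdx (1 + γ) (cdB x.toKIdx (fun _ _ => 1) ν (𝔏.GA (fun _ _ => 1) (liftY J (E : 𝔸)))),
            ⨆ ν : Fin (d + 1), wNormBY x.toKIdx (1 + γ) (𝔏.GA (fun _ _ => 1) (cdsB x.toKIdx (fun _ _ => 1) ν (liftY J (E : 𝔸)))),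
            wNormBY x.toKIdx γ (lapB x.toKIdx (fun _ _ => 1) (𝔏.GA (fun _ _ => 1) (liftY J (E : 𝔸))))] : Fin 4 → ℝ) n) := rfl

/-- ★ **THE (3.47) SLOT OF def-Y's G-READING AT `U = 1` ON A BOND ARGUMENT IS `≤ C|J|_{(γ)}`** given §2's four pointwise bounds for `J` at `γ` (every
entry `n`, every letter record `𝔏`: flatness clause `𝔏.GA_one`, sup over the unit ball).
[cite: Balaban1985BackgroundPropagators, Thm 3.3 p.399 + (3.47) p.398 + Cor. 3.5 p.407; Balaban1984PropagatorsII, Prop. 2.6 (2.136) p.247, Lemma 2.1 p.234] -/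
theorem GA_glob_one_inr_le (n : Fin 4) (J : FBondY x.toKIdx → ℝ) {γ C : ℝ} (hC : 0 ≤ C)
    (h : ∀ b : FBondY x.toKIdx,
      |Gop x.toKIdx J b| ≤ C * wNormB x.toKIdx γ J * (((ℓ : ℝ) + 1) ^ (blkV1 x.hN x.D b).1.1 * |x.cf|⁻¹) ^ ((2 : ℝ) + γ) ∧
      (∀ ν : Fin (d + 1), |DV ν x.cf (Gop x.toKIdx J) b| ≤
          C * wNormB x.toKIdx γ J * (((ℓ : ℝ) + 1) ^ (blkV1 x.hN x.D b).1.1 * |x.cf|⁻¹) ^ ((1 : ℝ) + γ)) ∧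
      (∀ ν : Fin (d + 1), |Gop x.toKIdx (DVa ν x.cf J) b| ≤
          C * wNormB x.toKIdx γ J * (((ℓ : ℝ) + 1) ^ (blkV1 x.hN x.D b).1.1 * |x.cf|⁻¹) ^ ((1 : ℝ) + γ)) ∧
      |LapV x.cf (Gop x.toKIdx J) b| ≤ C * wNormB x.toKIdx γ J * (((ℓ : ℝ) + 1) ^ (blkV1 x.hN x.D b).1.1 * |x.cf|⁻¹) ^ γ) :
    (operatorLayerYOfLetters 𝔸 G x 𝔏 𝔈).GA.glob n (bg9Y 𝔸 G x).one (Sum.inr J) γ ≤ C * wNormB x.toKIdx γ J := by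
  have hCN : 0 ≤ C * wNormB x.toKIdx γ J := mul_nonneg hC (wNormB_nonneg _ γ J)
  rw [GA_glob_one_inr]
  refine iSup_ball_le (fun E => ?_) hCN
  fin_cases n
  · exact globB0_one_le x.toKIdx 𝔏.GA 𝔏.GA_one J E hC (fun b => (h b).1)
  · exact Real.iSup_le (fun ν => globB1_one_le x.toKIdx 𝔏.GA 𝔏.GA_one J E ν hC (fun b => (h b).2.1 ν)) hCN
  · exact Real.iSup_le (fun ν => globB2_one_le x.toKIdx 𝔏.GA 𝔏.GA_one J E ν hC (fun b => (h b).2.2.1 ν)) hCN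
  · exact globB3_one_le x.toKIdx 𝔏.GA 𝔏.GA_one J E hC (fun b => (h b).2.2.2)

end Member

/-! ## §5 Row 12 at the layer of letters -/

section Layer

variable {G : Subgroup 𝔸ˣ} (hb₀ : 0 < b₀) (hb₁ : b₀ ≤ b₁) (𝔏 : ∀ x : MemberY d ℓ hd hL b₀ b₁ Mstar, CovLettersY 𝔸 x)
  (𝔈 : ∀ x : MemberY d ℓ hd hL b₀ b₁ Mstar, ExpLettersY 𝔸 G x)
include hb₀ hb₁

/-- ★★ **THE (3.47) LEAF OF G(1) ON BOND ARGUMENTS HOLDS AT NODE 00's LAYER OF LETTERS** — for EVERY family of letter records `𝔏` (printed `U = 1` clause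
`GA_one`) and expansion letters `𝔈`, band `0 < b₀ ≤ b₁`: ONE threshold and ONE `B₀` such that at every member above the threshold, every bond argument
`λ = .inr J`, every `γ ∈ [−4, 4]`, every entry: `(ops x).GA.glob n 1 λ γ ≤ B₀|λ|_{(γ)}` — (3.47) at `U = 1` for G from [4] (2.136) + Lemma 2.1.
[cite: Balaban1985BackgroundPropagators, Thm 3.3 p.399 + Thm 3.1 (3.47) p.398 + Cor. 3.5 p.407; Balaban1984PropagatorsII, Prop. 2.6 (2.136) p.247, Lemma 2.1 p.234] -/
theorem atOneGlobOn_GA_letters :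
    AtOneGlobOn geo9Y (bg9Y 𝔸 G) (fun x => (operatorLayerYOfLetters 𝔸 G x (𝔏 x) (𝔈 x)).GA) (fun _ lam => lam.isRight = true) := by
  obtain ⟨M₁, C, hM₁, hC, H⟩ := ineq347_G_kIdx (d := d) (ℓ := ℓ) (hd := hd) (hL := hL) hb₀ hb₁ 4
  refine ⟨M₁, C, hM₁, hC, fun x hx n lam γ hP hγ₁ hγ₂ => ?_⟩
  cases lam with
  | inl f => exact absurd hP (by simp)
  | inr J =>
      exact GA_glob_one_inr_le x (𝔏 x) (𝔈 x) n J hC.le (fun b => H x.toKIdx hx γ (abs_le.2 ⟨by linarith, hγ₂⟩) J b)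

/-- ★★ **ROW `hGA` HOLDS AT NODE 00's LAYER OF LETTERS** (`B9FromB6.ResidualGAGlobAtOne` for `(ops ·).GA`: every argument — OFF the bond summand the
reading is `0`, `B9ResidualEntriesAtOneAtLetters.residualGAGlobAtOne_letters_of_globOn`), every `𝔏 𝔈`, band `0 < b₀ ≤ b₁`.
[cite: Balaban1985BackgroundPropagators, Thm 3.3 p.399 + (3.47) p.398 + Cor. 3.5 p.407; Balaban1984PropagatorsII, Prop. 2.6 (2.136) p.247, Lemma 2.1 p.234] -/
theorem residualGAGlobAtOne_GA_letters :
    ResidualGAGlobAtOne geo9Y (bg9Y 𝔸 G) (fun x => (operatorLayerYOfLetters 𝔸 G x (𝔏 x) (𝔈 x)).GA) :=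
  residualGAGlobAtOne_letters_of_globOn 𝔏 𝔈 (atOneGlobOn_GA_letters hb₀ hb₁ 𝔏 𝔈)

end Layer

/-! ## §6 At the record: ROW 12 at `ops := opsYOfLetters N θ M⋆ 𝔏 𝔈` -/

section Record

open scoped Matrix.Norms.L2Operator

variable (N : ℕ) (θ : Stage3Params) (Mstar' : ℕ) (𝔏 : LettersY N θ Mstar') (𝔈 : ExpsY N θ Mstar')

/-- ★★ the (3.47) leaf of G(1) on bond arguments at the record's layer of letters (band from `θ.hb`), every `𝔏 𝔈`.
[cite: Balaban1985BackgroundPropagators, Thm 3.3 p.399 + (3.47) p.398 + Cor. 3.5 p.407; Balaban1984PropagatorsII, Prop. 2.6 (2.136) p.247] -/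
theorem atOneGlobOn_GA_opsYOfLetters :
    AtOneGlobOn geo9Y (bg9Y (Matrix (Fin N) (Fin N) ℂ) (specialUnitaryUnits (Fin N))) (fun x => (opsYOfLetters N θ Mstar' 𝔏 𝔈 x).GA)
      (fun _ lam => lam.isRight = true) :=
  atOneGlobOn_GA_letters θ.hb.1 θ.hb.2 𝔏 𝔈

/-- ★★★ **THE KNIT BINDER `hGA` AT NODE 00's OPERATOR LAYER OF LETTERS — ROW 12 OF THE N06 KNIT, NO HYPOTHESIS**: for EVERY family of letter records
`𝔏` and expansion letters `𝔈`, `B9FromB6.ResidualGAGlobAtOne geo9Y (bg9Y …) (fun x => (opsYOfLetters N θ M⋆ 𝔏 𝔈 x).GA)` — LITERALLY the binder `hGA` of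
`Summit.…b9_main_of_up_view₁₁B10YZW_of_obligations` at `ops := opsYOfLetters N θ M⋆ 𝔏 𝔈` ((3.47) at U = 1 for G = Δ_a⁻¹: [4] (2.136), N03's theorem of
record on the census, + Lemma 2.1, lit-balaban-p21's torus machinery; band `θ.hb`). [cite: Balaban1985BackgroundPropagators, Cor. 3.5 p.407 + Thm 3.3 p.399 + (3.47) p.398; Balaban1984PropagatorsII, Prop. 2.6 (2.136) p.247, Lemma 2.1 (2.60)–(2.61) p.234] -/
theorem hGA_opsYOfLetters :
    B9FromB6.ResidualGAGlobAtOne geo9Y (bg9Y (Matrix (Fin N) (Fin N) ℂ) (specialUnitaryUnits (Fin N)))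
      (fun x => (opsYOfLetters N θ Mstar' 𝔏 𝔈 x).GA) :=
  residualGAGlobAtOne_GA_letters θ.hb.1 θ.hb.2 𝔏 𝔈

end Record

end Literature.MathematicalPhysics.QuantumFieldTheory.Balaban1983to89.B9Ineq347GAAtLetters

end
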